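import Summits.Ventures.HSemireg.TwoSlotGlue

/-!
# The registered closed forms ARE the divided powers of the class 2-form (pub-hsemireg, S4-PUSH corner 2)

Kernel leg of seat s4-search-2 gen 16 (cell `pub-hsemireg`); FILE I of the composition of the (2,2,3,3,3,3) edge unit's
CLASS-DEAD route into ONE theorem (FILE II = `EdgeUnitClassDead.lean`).  Memo of record
`s4push/search-2/g11/LIFT2-search-2-g11.md` («S2-21») §5; framework PREREG-S2-18∕19 (CRITERION L is stated with the
divided powers `B^[2]`, `B^[3]` of the integral class 2-form `B`).  The tree's digit identities (`DegreeSixSecondDigit`,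
`TwoSlotGlue`, gen 15's rows `TwoAdicReadings` ∕ `LeadingDigitRemainder`) take REGISTERED CLOSED FORMS of those divided
powers as hypotheses (`hE₂ : E₂ = C₂ + 2·C·Z + 4·Z₂`, `hB₂ : B₂ = (1+2η)²H₂ + …`, …).  This file proves, for the ACTUAL
2-vectors of Mathlib's `ExteriorAlgebra R M` (any commutative ring `R`, any module `M`, any twelve vectors, NO table
hypothesis), that the class 2-form `B` of each branch satisfies `B·B = 2·(closed form)` and `B·B·B = 6·(closed form)` —
so that, by torsion-freeness (`LeadingDigitRemainder.natCast_mul_cancel`), ANY `B₂, B₃` with `B·B = 2B₂`, `B·B·B = 6B₃`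
(the intrinsic divided powers) coincide with the registered closed forms:

* `sq_shift_two` ∕ `cube_shift_two` ∕ `sq_shift_four` ∕ `cube_shift_four` (any commutative ring): the divided-power
  binomial law for `B = C + 2X` and `B = B₀ + 4Y` given `C² = 2C₂, C³ = 6C₃, X² = 2X₂, X³ = 6X₃` (resp. for `B₀, Y`).
* `closedForms_leading` (branches LEMMA D(a) ∕ LEMMA A(a)): `B = C + 2X`, `C = β₀₁h₀ + β₂₃h₁ + N` a leading digit on the
  slot pair with the registered `C₂, C₃` of `LeadingDigitRemainder.lemmaD_a_reading`, `X` ANY element of the 2-vector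
  subalgebra `Λ` with `X·X = 2X₂`, `X·X·X = 6X₃`: `B·B = 2·(C₂ + 2CX + 4X₂)` and `B·B·B = 6·(C₃ + 2C₂X + 4CX₂ + 8X₃)` —
  the shapes `hE₂`, `hE₃` (`Z := X`) of `lemmaD_a_reading` and `hE` (`Y := 0`) of `lemmaA_a_chain`.
* `closedForms_edge` (branch `H̄`): `B = H + 2X'`: `B·B = 2·(H₂ + 2HX' + 4X'₂)` — the shape `hE` of
  `LeadingDigitRemainder.edge_digit_equation`.
* `closedForms_lemmaB` (LEMMA B): `B = B₀ + 4Y`, `B₀ = (1+2η)H + 2S₁ + 2L` with the registered `B₀₂, B₀₃` of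
  `TwoAdicReadings.lemmaB_reading`, `Y ∈ Λ` with `Y·Y = 2Y₂`, `Y·Y·Y = 6Y₃`: `B·B = 2·(B₀₂ + 4B₀Y + 16Y₂)` and
  `B·B·B = 6·(B₀₃ + 4B₀₂Y + 16B₀Y₂ + 64Y₃)` — the shapes `hE₂`, `hE₃` of `lemmaB_reading`.

Method (as in `TwoSlotGlue`): the pinning identities `sq_C ∕ cube_C ∕ sq_B ∕ cube_B` of `DegreeSixSecondDigit` and the atom
laws of `TwoSlotFrameTable` are instantiated in the COMMUTATIVE 2-vector subalgebra `Λ`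
(`TwoSlotGlue.isMulCommutative_twoVectorSubalgebra`), the table entries being `twoVector_mul_self ∕ table_zero_* ∕
table_signed`, and pushed through `Λ → ExteriorAlgebra R M`.  The existence of `X₂, X₃, Y₂, Y₃` in `Λ` for integral
2-forms is `TwoVectorDividedPowers.exists_dividedPowers_of_mem_span` (gen 16, ROW H).

Honest framing: ring identities (theorems only, count-neutral, no `def`); CLASS-LEVEL necessary-condition bookkeeping
(CRITERION L) at the special fibre `E⁶`; no object, no `σ` computation, no Hodge statement; nothing here bears on
HC ∕ HC_CM ∕ HC_AV.
-/

namespace Summit.Ventures.HSemireg.EdgeUnitClosedForms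

open ExteriorAlgebra TwoSlotFrameTable DegreeSixSecondDigit
open scoped IsMulCommutative

section Shift

/-! ### 1. The divided-power binomial law (any commutative ring) -/

variable {R : Type*} [CommRing R]

/-- `B = C + 2X`, `C² = 2C₂`, `X² = 2X₂` ⟹ `B² = 2·(C₂ + 2CX + 4X₂)` (`(C + 2X)^[2] = C^[2] + 2CX + 4X^[2]`). -/
theorem sq_shift_two (C C₂ X X₂ B : R) (hB : B = C + 2 * X) (qC : C * C = 2 * C₂) (qX : X * X = 2 * X₂) :
    B * B = 2 * (C₂ + 2 * (C * X) + 4 * X₂) := by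
  linear_combination (B + C + 2 * X) * hB + qC + 4 * qX

/-- `B = C + 2X`, `C² = 2C₂`, `C³ = 6C₃`, `X² = 2X₂`, `X³ = 6X₃` ⟹ `B³ = 6·(C₃ + 2C₂X + 4CX₂ + 8X₃)`. -/
theorem cube_shift_two (C C₂ C₃ X X₂ X₃ B : R) (hB : B = C + 2 * X) (qC : C * C = 2 * C₂)
    (cC : C * C * C = 6 * C₃) (qX : X * X = 2 * X₂) (cX : X * X * X = 6 * X₃) :
    B * B * B = 6 * (C₃ + 2 * (C₂ * X) + 4 * (C * X₂) + 8 * X₃) := by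
  linear_combination (B * B + B * (C + 2 * X) + (C + 2 * X) ^ 2) * hB + cC + (6 * X) * qC + (12 * C) * qX +
    8 * cX

/-- `B = B₀ + 4Y`, `B₀² = 2B₀₂`, `Y² = 2Y₂` ⟹ `B² = 2·(B₀₂ + 4B₀Y + 16Y₂)`. -/
theorem sq_shift_four (B₀ B₀₂ Y Y₂ B : R) (hB : B = B₀ + 4 * Y) (qB₀ : B₀ * B₀ = 2 * B₀₂) (qY : Y * Y = 2 * Y₂) :
    B * B = 2 * (B₀₂ + 4 * (B₀ * Y) + 16 * Y₂) := by
  linear_combination (B + B₀ + 4 * Y) * hB + qB₀ + 16 * qY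

/-- `B = B₀ + 4Y`, `B₀² = 2B₀₂`, `B₀³ = 6B₀₃`, `Y² = 2Y₂`, `Y³ = 6Y₃` ⟹ `B³ = 6·(B₀₃ + 4B₀₂Y + 16B₀Y₂ + 64Y₃)`. -/
theorem cube_shift_four (B₀ B₀₂ B₀₃ Y Y₂ Y₃ B : R) (hB : B = B₀ + 4 * Y) (qB₀ : B₀ * B₀ = 2 * B₀₂)
    (cB₀ : B₀ * B₀ * B₀ = 6 * B₀₃) (qY : Y * Y = 2 * Y₂) (cY : Y * Y * Y = 6 * Y₃) :
    B * B * B = 6 * (B₀₃ + 4 * (B₀₂ * Y) + 16 * (B₀ * Y₂) + 64 * Y₃) := by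
  linear_combination (B * B + B * (B₀ + 4 * Y) + (B₀ + 4 * Y) ^ 2) * hB + cB₀ + (12 * Y) * qB₀ + (48 * B₀) * qY +
    64 * cY

end Shift

section Exterior

/-! ### 2. The three class 2-forms of the edge unit, in `ExteriorAlgebra R M` -/

variable {R : Type*} [CommRing R] {M : Type*} [AddCommGroup M] [Module R M]

/-- **The leading-digit branches (LEMMA D(a), LEMMA A(a)).**  Twelve vectors `x i`, slots `h₀ = ι x₀ ι x₁`,
`h₁ = ι x₂ ι x₃`, cross lines `l₁, …, l₄`; a leading digit `C = β₀₁h₀ + β₂₃h₁ + N`, `N = n₁l₁ + ⋯ + n₄l₄` with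
coefficients ANY elements of the 2-vector subalgebra `Λ`, its registered closed forms `C₂`, `C₃` (with the registered
`N₂`), exactly as in `LeadingDigitRemainder.lemmaD_a_reading`; a tail `X ∈ Λ` with divided powers `X·X = 2X₂`,
`X·X·X = 6X₃`; the class 2-form `B = C + 2X`.  Then `B·B = 2·(C₂ + 2·C·X + 4·X₂)` and
`B·B·B = 6·(C₃ + 2·C₂·X + 4·C·X₂ + 8·X₃)`: the intrinsic divided powers of `B` ARE the registered closed forms
(`hE₂`, `hE₃` of `lemmaD_a_reading` at `Z := X`; `hE` of `lemmaA_a_chain` at `Y := 0`), up to cancelling `2` ∕ `6`. -/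
theorem closedForms_leading (x : Fin 12 → M) (Λ : Subalgebra R (ExteriorAlgebra R M))
    (h₀ h₁ l₁ l₂ l₃ l₄ n₁ n₂ n₃ n₄ β₀₁ β₂₃ N N₂ C C₂ C₃ X X₂ X₃ B : ExteriorAlgebra R M)
    (hΛ : Λ = Algebra.adjoin R (Set.range fun p : M × M => ι R p.1 * ι R p.2))
    (hh₀ : h₀ = ι R (x 0) * ι R (x 1)) (hh₁ : h₁ = ι R (x 2) * ι R (x 3)) (hl₁ : l₁ = ι R (x 0) * ι R (x 2))
    (hl₂ : l₂ = ι R (x 0) * ι R (x 3)) (hl₃ : l₃ = ι R (x 1) * ι R (x 2)) (hl₄ : l₄ = ι R (x 1) * ι R (x 3))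
    (mn₁ : n₁ ∈ Λ) (mn₂ : n₂ ∈ Λ) (mn₃ : n₃ ∈ Λ) (mn₄ : n₄ ∈ Λ) (mβ₀₁ : β₀₁ ∈ Λ) (mβ₂₃ : β₂₃ ∈ Λ) (mX : X ∈ Λ)
    (mX₂ : X₂ ∈ Λ) (mX₃ : X₃ ∈ Λ)
    (hN : N = n₁ * l₁ + n₂ * l₂ + n₃ * l₃ + n₄ * l₄)
    (hN₂ : N₂ = n₁ * l₁ * (n₂ * l₂) + n₁ * l₁ * (n₃ * l₃) + n₁ * l₁ * (n₄ * l₄) + n₂ * l₂ * (n₃ * l₃)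
      + n₂ * l₂ * (n₄ * l₄) + n₃ * l₃ * (n₄ * l₄))
    (hC : C = β₀₁ * h₀ + β₂₃ * h₁ + N) (hC₂ : C₂ = β₀₁ * β₂₃ * (h₀ * h₁) + (β₀₁ * h₀ + β₂₃ * h₁) * N + N₂)
    (hC₃ : C₃ = β₀₁ * β₂₃ * (h₀ * h₁) * N + (β₀₁ * h₀ + β₂₃ * h₁) * N₂)
    (qX : X * X = 2 * X₂) (cX : X * X * X = 6 * X₃) (hB : B = C + 2 * X) :
    B * B = 2 * (C₂ + 2 * (C * X) + 4 * X₂) ∧ B * B * B = 6 * (C₃ + 2 * (C₂ * X) + 4 * (C * X₂) + 8 * X₃) := by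
  subst hΛ
  haveI := TwoSlotGlue.isMulCommutative_twoVectorSubalgebra (R := R) (M := M)
  set Λ := Algebra.adjoin R (Set.range fun p : M × M => ι R p.1 * ι R p.2)
  have mh₀ : h₀ ∈ Λ := Algebra.subset_adjoin ⟨(x 0, x 1), hh₀.symm⟩
  have mh₁ : h₁ ∈ Λ := Algebra.subset_adjoin ⟨(x 2, x 3), hh₁.symm⟩
  have ml₁ : l₁ ∈ Λ := Algebra.subset_adjoin ⟨(x 0, x 2), hl₁.symm⟩
  have ml₂ : l₂ ∈ Λ := Algebra.subset_adjoin ⟨(x 0, x 3), hl₂.symm⟩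
  have ml₃ : l₃ ∈ Λ := Algebra.subset_adjoin ⟨(x 1, x 2), hl₃.symm⟩
  have ml₄ : l₄ ∈ Λ := Algebra.subset_adjoin ⟨(x 1, x 3), hl₄.symm⟩
  have qh₀ : (⟨h₀, mh₀⟩ : Λ) * ⟨h₀, mh₀⟩ = 0 := Subtype.ext (by subst hh₀; exact twoVector_mul_self (x 0) (x 1))
  have qh₁ : (⟨h₁, mh₁⟩ : Λ) * ⟨h₁, mh₁⟩ = 0 := Subtype.ext (by subst hh₁; exact twoVector_mul_self (x 2) (x 3))
  have ql₁ : (⟨l₁, ml₁⟩ : Λ) * ⟨l₁, ml₁⟩ = 0 := Subtype.ext (by subst hl₁; exact twoVector_mul_self (x 0) (x 2))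
  have ql₂ : (⟨l₂, ml₂⟩ : Λ) * ⟨l₂, ml₂⟩ = 0 := Subtype.ext (by subst hl₂; exact twoVector_mul_self (x 0) (x 3))
  have ql₃ : (⟨l₃, ml₃⟩ : Λ) * ⟨l₃, ml₃⟩ = 0 := Subtype.ext (by subst hl₃; exact twoVector_mul_self (x 1) (x 2))
  have ql₄ : (⟨l₄, ml₄⟩ : Λ) * ⟨l₄, ml₄⟩ = 0 := Subtype.ext (by subst hl₄; exact twoVector_mul_self (x 1) (x 3))
  have zh₀l₁ : (⟨h₀, mh₀⟩ : Λ) * ⟨l₁, ml₁⟩ = 0 := Subtype.ext (by subst hh₀ hl₁; exact table_zero_ff (x 0) (x 1) (x 2))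
  have zh₀l₂ : (⟨h₀, mh₀⟩ : Λ) * ⟨l₂, ml₂⟩ = 0 := Subtype.ext (by subst hh₀ hl₂; exact table_zero_ff (x 0) (x 1) (x 3))
  have zh₀l₃ : (⟨h₀, mh₀⟩ : Λ) * ⟨l₃, ml₃⟩ = 0 := Subtype.ext (by subst hh₀ hl₃; exact table_zero_st (x 0) (x 1) (x 2))
  have zh₀l₄ : (⟨h₀, mh₀⟩ : Λ) * ⟨l₄, ml₄⟩ = 0 := Subtype.ext (by subst hh₀ hl₄; exact table_zero_st (x 0) (x 1) (x 3))
  have zh₁l₁ : (⟨h₁, mh₁⟩ : Λ) * ⟨l₁, ml₁⟩ = 0 := Subtype.ext (by subst hh₁ hl₁; exact table_zero_fl (x 2) (x 3) (x 0))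
  have zh₁l₂ : (⟨h₁, mh₁⟩ : Λ) * ⟨l₂, ml₂⟩ = 0 := Subtype.ext (by subst hh₁ hl₂; exact table_zero_sl (x 2) (x 3) (x 0))
  have zh₁l₃ : (⟨h₁, mh₁⟩ : Λ) * ⟨l₃, ml₃⟩ = 0 := Subtype.ext (by subst hh₁ hl₃; exact table_zero_fl (x 2) (x 3) (x 1))
  have zh₁l₄ : (⟨h₁, mh₁⟩ : Λ) * ⟨l₄, ml₄⟩ = 0 := Subtype.ext (by subst hh₁ hl₄; exact table_zero_sl (x 2) (x 3) (x 1))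
  have zl₁l₂ : (⟨l₁, ml₁⟩ : Λ) * ⟨l₂, ml₂⟩ = 0 := Subtype.ext (by subst hl₁ hl₂; exact table_zero_ff (x 0) (x 2) (x 3))
  have zl₁l₃ : (⟨l₁, ml₁⟩ : Λ) * ⟨l₃, ml₃⟩ = 0 := Subtype.ext (by subst hl₁ hl₃; exact table_zero_sl (x 0) (x 2) (x 1))
  have zl₂l₄ : (⟨l₂, ml₂⟩ : Λ) * ⟨l₄, ml₄⟩ = 0 := Subtype.ext (by subst hl₂ hl₄; exact table_zero_sl (x 0) (x 3) (x 1))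
  have zl₃l₄ : (⟨l₃, ml₃⟩ : Λ) * ⟨l₄, ml₄⟩ = 0 := Subtype.ext (by subst hl₃ hl₄; exact table_zero_ff (x 1) (x 2) (x 3))
  have pl₁l₄ : (⟨l₁, ml₁⟩ : Λ) * ⟨l₄, ml₄⟩ = -(⟨h₀, mh₀⟩ * ⟨h₁, mh₁⟩) :=
    Subtype.ext (by subst hl₁ hl₄ hh₀ hh₁; exact (table_signed (x 0) (x 1) (x 2) (x 3)).1)
  have pl₂l₃ : (⟨l₂, ml₂⟩ : Λ) * ⟨l₃, ml₃⟩ = ⟨h₀, mh₀⟩ * ⟨h₁, mh₁⟩ :=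
    Subtype.ext (by subst hl₂ hl₃ hh₀ hh₁; exact (table_signed (x 0) (x 1) (x 2) (x 3)).2)
  -- the cross-line atom laws in Λ
  have mN : N ∈ Λ := by
    subst hN; exact Λ.add_mem (Λ.add_mem (Λ.add_mem (Λ.mul_mem mn₁ ml₁) (Λ.mul_mem mn₂ ml₂))
      (Λ.mul_mem mn₃ ml₃)) (Λ.mul_mem mn₄ ml₄)
  have hNΛ : (⟨N, mN⟩ : Λ) = ⟨n₁, mn₁⟩ * ⟨l₁, ml₁⟩ + ⟨n₂, mn₂⟩ * ⟨l₂, ml₂⟩ + ⟨n₃, mn₃⟩ * ⟨l₃, ml₃⟩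
      + ⟨n₄, mn₄⟩ * ⟨l₄, ml₄⟩ := Subtype.ext (by push_cast; exact hN)
  have zh₀N := crossLine_h₀ (⟨h₀, mh₀⟩ : Λ) ⟨l₁, ml₁⟩ ⟨l₂, ml₂⟩ ⟨l₃, ml₃⟩ ⟨l₄, ml₄⟩ ⟨n₁, mn₁⟩ ⟨n₂, mn₂⟩
    ⟨n₃, mn₃⟩ ⟨n₄, mn₄⟩ ⟨N, mN⟩ hNΛ zh₀l₁ zh₀l₂ zh₀l₃ zh₀l₄
  have zh₁N := crossLine_h₁ (⟨h₁, mh₁⟩ : Λ) ⟨l₁, ml₁⟩ ⟨l₂, ml₂⟩ ⟨l₃, ml₃⟩ ⟨l₄, ml₄⟩ ⟨n₁, mn₁⟩ ⟨n₂, mn₂⟩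
    ⟨n₃, mn₃⟩ ⟨n₄, mn₄⟩ ⟨N, mN⟩ hNΛ zh₁l₁ zh₁l₂ zh₁l₃ zh₁l₄
  have qNΛ := crossLine_sq (⟨h₀, mh₀⟩ : Λ) ⟨h₁, mh₁⟩ ⟨l₁, ml₁⟩ ⟨l₂, ml₂⟩ ⟨l₃, ml₃⟩ ⟨l₄, ml₄⟩ ⟨n₁, mn₁⟩ ⟨n₂, mn₂⟩
    ⟨n₃, mn₃⟩ ⟨n₄, mn₄⟩ ⟨N, mN⟩ hNΛ ql₁ ql₂ ql₃ ql₄ zl₁l₂ zl₁l₃ zl₂l₄ zl₃l₄ pl₁l₄ pl₂l₃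
  have mN₂ : N₂ ∈ Λ := by
    subst hN₂
    exact Λ.add_mem (Λ.add_mem (Λ.add_mem (Λ.add_mem (Λ.add_mem
      (Λ.mul_mem (Λ.mul_mem mn₁ ml₁) (Λ.mul_mem mn₂ ml₂)) (Λ.mul_mem (Λ.mul_mem mn₁ ml₁) (Λ.mul_mem mn₃ ml₃)))
      (Λ.mul_mem (Λ.mul_mem mn₁ ml₁) (Λ.mul_mem mn₄ ml₄))) (Λ.mul_mem (Λ.mul_mem mn₂ ml₂) (Λ.mul_mem mn₃ ml₃)))
      (Λ.mul_mem (Λ.mul_mem mn₂ ml₂) (Λ.mul_mem mn₄ ml₄))) (Λ.mul_mem (Λ.mul_mem mn₃ ml₃) (Λ.mul_mem mn₄ ml₄))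
  have hN₂Λ := crossLine_dividedSquare (⟨h₀, mh₀⟩ : Λ) ⟨h₁, mh₁⟩ ⟨l₁, ml₁⟩ ⟨l₂, ml₂⟩ ⟨l₃, ml₃⟩ ⟨l₄, ml₄⟩
    ⟨n₁, mn₁⟩ ⟨n₂, mn₂⟩ ⟨n₃, mn₃⟩ ⟨n₄, mn₄⟩ ⟨N₂, mN₂⟩ (Subtype.ext (by push_cast; exact hN₂)) zl₁l₂ zl₁l₃
    zl₂l₄ zl₃l₄ pl₁l₄ pl₂l₃
  have qN : (⟨N, mN⟩ : Λ) * ⟨N, mN⟩ = 2 * ⟨N₂, mN₂⟩ := by rw [qNΛ, hN₂Λ]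
  -- the pinning identities `C·C = 2C₂`, `C·C·C = 6C₃` in Λ
  have mC : C ∈ Λ := by subst hC; exact Λ.add_mem (Λ.add_mem (Λ.mul_mem mβ₀₁ mh₀) (Λ.mul_mem mβ₂₃ mh₁)) mN
  have hCΛ : (⟨C, mC⟩ : Λ) = ⟨β₀₁, mβ₀₁⟩ * ⟨h₀, mh₀⟩ + ⟨β₂₃, mβ₂₃⟩ * ⟨h₁, mh₁⟩ + ⟨N, mN⟩ :=
    Subtype.ext (by push_cast; exact hC)
  have mC₂ : C₂ ∈ Λ := by
    subst hC₂; exact Λ.add_mem (Λ.add_mem (Λ.mul_mem (Λ.mul_mem mβ₀₁ mβ₂₃) (Λ.mul_mem mh₀ mh₁))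
      (Λ.mul_mem (Λ.add_mem (Λ.mul_mem mβ₀₁ mh₀) (Λ.mul_mem mβ₂₃ mh₁)) mN)) mN₂
  have hC₂Λ : (⟨C₂, mC₂⟩ : Λ) = ⟨β₀₁, mβ₀₁⟩ * ⟨β₂₃, mβ₂₃⟩ * (⟨h₀, mh₀⟩ * ⟨h₁, mh₁⟩)
      + (⟨β₀₁, mβ₀₁⟩ * ⟨h₀, mh₀⟩ + ⟨β₂₃, mβ₂₃⟩ * ⟨h₁, mh₁⟩) * ⟨N, mN⟩ + ⟨N₂, mN₂⟩ :=
    Subtype.ext (by push_cast; exact hC₂)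
  have mC₃ : C₃ ∈ Λ := by
    subst hC₃; exact Λ.add_mem (Λ.mul_mem (Λ.mul_mem (Λ.mul_mem mβ₀₁ mβ₂₃) (Λ.mul_mem mh₀ mh₁)) mN)
      (Λ.mul_mem (Λ.add_mem (Λ.mul_mem mβ₀₁ mh₀) (Λ.mul_mem mβ₂₃ mh₁)) mN₂)
  have hC₃Λ : (⟨C₃, mC₃⟩ : Λ) = ⟨β₀₁, mβ₀₁⟩ * ⟨β₂₃, mβ₂₃⟩ * (⟨h₀, mh₀⟩ * ⟨h₁, mh₁⟩) * ⟨N, mN⟩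
      + (⟨β₀₁, mβ₀₁⟩ * ⟨h₀, mh₀⟩ + ⟨β₂₃, mβ₂₃⟩ * ⟨h₁, mh₁⟩) * ⟨N₂, mN₂⟩ :=
    Subtype.ext (by push_cast; exact hC₃)
  have qC := sq_C (R := Λ) ⟨h₀, mh₀⟩ ⟨h₁, mh₁⟩ ⟨β₀₁, mβ₀₁⟩ ⟨β₂₃, mβ₂₃⟩ ⟨N, mN⟩ ⟨N₂, mN₂⟩ ⟨C, mC⟩ ⟨C₂, mC₂⟩
    hCΛ hC₂Λ qh₀ qh₁ qN
  have cC := cube_C (R := Λ) ⟨h₀, mh₀⟩ ⟨h₁, mh₁⟩ (⟨n₂, mn₂⟩ * ⟨n₃, mn₃⟩ - ⟨n₁, mn₁⟩ * ⟨n₄, mn₄⟩) ⟨β₀₁, mβ₀₁⟩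
    ⟨β₂₃, mβ₂₃⟩ ⟨N, mN⟩ ⟨N₂, mN₂⟩ ⟨C, mC⟩ ⟨C₃, mC₃⟩ hCΛ hC₃Λ qh₀ qh₁ zh₀N zh₁N qN hN₂Λ
  -- the tail and the binomial law in Λ, pushed to the exterior algebra
  have qXΛ : (⟨X, mX⟩ : Λ) * ⟨X, mX⟩ = 2 * ⟨X₂, mX₂⟩ := Subtype.ext (by push_cast; exact qX)
  have cXΛ : (⟨X, mX⟩ : Λ) * ⟨X, mX⟩ * ⟨X, mX⟩ = 6 * ⟨X₃, mX₃⟩ := Subtype.ext (by push_cast; exact cX)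
  have mB : B ∈ Λ := by subst hB; exact Λ.add_mem mC (Λ.mul_mem (Λ.natCast_mem 2) mX)
  have hBΛ : (⟨B, mB⟩ : Λ) = ⟨C, mC⟩ + 2 * ⟨X, mX⟩ := Subtype.ext (by push_cast; exact hB)
  have k₂ := congrArg Subtype.val (sq_shift_two (R := Λ) _ _ _ _ _ hBΛ qC qXΛ)
  have k₃ := congrArg Subtype.val (cube_shift_two (R := Λ) _ _ _ _ _ _ _ hBΛ qC cC qXΛ cXΛ)
  push_cast at k₂ k₃
  exact ⟨k₂, k₃⟩

/-- **The branch `H̄` at degree 4.**  `B = H + 2X'` with `H = h₀ + h₁` (`h₀ = ι x₀ ι x₁`, `h₁ = ι x₂ ι x₃`),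
`X' ∈ Λ` with `X'·X' = 2X'₂`: `B·B = 2·(H₂ + 2·H·X' + 4·X'₂)`, `H₂ = h₀h₁` — the shape `hE` (at `Y := 0`) of
`LeadingDigitRemainder.edge_digit_equation`. -/
theorem closedForms_edge (x : Fin 12 → M) (Λ : Subalgebra R (ExteriorAlgebra R M))
    (h₀ h₁ H H₂ X X₂ B : ExteriorAlgebra R M)
    (hΛ : Λ = Algebra.adjoin R (Set.range fun p : M × M => ι R p.1 * ι R p.2))
    (hh₀ : h₀ = ι R (x 0) * ι R (x 1)) (hh₁ : h₁ = ι R (x 2) * ι R (x 3)) (mX : X ∈ Λ) (mX₂ : X₂ ∈ Λ)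
    (hH : H = h₀ + h₁) (hH₂ : H₂ = h₀ * h₁) (qX : X * X = 2 * X₂) (hB : B = H + 2 * X) :
    B * B = 2 * (H₂ + 2 * (H * X) + 4 * X₂) := by
  subst hΛ
  haveI := TwoSlotGlue.isMulCommutative_twoVectorSubalgebra (R := R) (M := M)
  set Λ := Algebra.adjoin R (Set.range fun p : M × M => ι R p.1 * ι R p.2)
  have mh₀ : h₀ ∈ Λ := Algebra.subset_adjoin ⟨(x 0, x 1), hh₀.symm⟩
  have mh₁ : h₁ ∈ Λ := Algebra.subset_adjoin ⟨(x 2, x 3), hh₁.symm⟩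
  have qh₀ : (⟨h₀, mh₀⟩ : Λ) * ⟨h₀, mh₀⟩ = 0 := Subtype.ext (by subst hh₀; exact twoVector_mul_self (x 0) (x 1))
  have qh₁ : (⟨h₁, mh₁⟩ : Λ) * ⟨h₁, mh₁⟩ = 0 := Subtype.ext (by subst hh₁; exact twoVector_mul_self (x 2) (x 3))
  have mH : H ∈ Λ := by subst hH; exact Λ.add_mem mh₀ mh₁
  have mH₂ : H₂ ∈ Λ := by subst hH₂; exact Λ.mul_mem mh₀ mh₁
  have qH := pairSum_sq (R := Λ) ⟨h₀, mh₀⟩ ⟨h₁, mh₁⟩ ⟨H, mH⟩ ⟨H₂, mH₂⟩ (Subtype.ext (by push_cast; exact hH))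
    (Subtype.ext (by push_cast; exact hH₂)) qh₀ qh₁
  have qXΛ : (⟨X, mX⟩ : Λ) * ⟨X, mX⟩ = 2 * ⟨X₂, mX₂⟩ := Subtype.ext (by push_cast; exact qX)
  have mB : B ∈ Λ := by subst hB; exact Λ.add_mem mH (Λ.mul_mem (Λ.natCast_mem 2) mX)
  have hBΛ : (⟨B, mB⟩ : Λ) = ⟨H, mH⟩ + 2 * ⟨X, mX⟩ := Subtype.ext (by push_cast; exact hB)
  have k₂ := congrArg Subtype.val (sq_shift_two (R := Λ) _ _ _ _ _ hBΛ qH qXΛ)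
  push_cast at k₂
  exact k₂

/-- **The LEMMA B branch.**  In the setting of `TwoAdicReadings.lemmaB_reading` (`B₀ = (1 + 2η)H + 2S₁ + 2L`,
`L = a l₁ + b l₂ + c l₃ + d l₄`, the registered closed forms `B₀₂`, `B₀₃` with `L₂ = (bc − ad)H₂`; parameters ANY
elements of `Λ`), for a remainder `Y ∈ Λ` with `Y·Y = 2Y₂`, `Y·Y·Y = 6Y₃` and the class 2-form `B = B₀ + 4Y`:
`B·B = 2·(B₀₂ + 4·B₀·Y + 16·Y₂)` and `B·B·B = 6·(B₀₃ + 4·B₀₂·Y + 16·B₀·Y₂ + 64·Y₃)` — the shapes `hE₂`, `hE₃` of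
`lemmaB_reading`.  (The atom laws `H² = 2H₂, HH₂ = 0, S₁² = 2S₂, S₁S₂ = 3S₃, HL = H₂L = 0, L² = 2L₂` are
`TwoSlotFrameTable.pairSum_* ∕ slotSum_* ∕ crossLine_*` on the 2-vector table, as in `TwoSlotGlue.lemmaB_exterior`.) -/
theorem closedForms_lemmaB (x : Fin 12 → M) (Λ : Subalgebra R (ExteriorAlgebra R M))
    (h₀ h₁ l₁ l₂ l₃ l₄ h₂ h₃ h₄ h₅ η a b c d H H₂ S₁ S₂ S₃ L L₂ B₀ B₀₂ B₀₃ Y Y₂ Y₃ B : ExteriorAlgebra R M)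
    (hΛ : Λ = Algebra.adjoin R (Set.range fun p : M × M => ι R p.1 * ι R p.2))
    (hh₀ : h₀ = ι R (x 0) * ι R (x 1)) (hh₁ : h₁ = ι R (x 2) * ι R (x 3)) (hl₁ : l₁ = ι R (x 0) * ι R (x 2))
    (hl₂ : l₂ = ι R (x 0) * ι R (x 3)) (hl₃ : l₃ = ι R (x 1) * ι R (x 2)) (hl₄ : l₄ = ι R (x 1) * ι R (x 3))
    (hh₂ : h₂ = ι R (x 4) * ι R (x 5)) (hh₃ : h₃ = ι R (x 6) * ι R (x 7)) (hh₄ : h₄ = ι R (x 8) * ι R (x 9))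
    (hh₅ : h₅ = ι R (x 10) * ι R (x 11)) (mη : η ∈ Λ) (ma : a ∈ Λ) (mb : b ∈ Λ) (mc : c ∈ Λ) (md : d ∈ Λ)
    (mY : Y ∈ Λ) (mY₂ : Y₂ ∈ Λ) (mY₃ : Y₃ ∈ Λ)
    (hH : H = h₀ + h₁) (hH₂ : H₂ = h₀ * h₁) (hS₁ : S₁ = h₂ + h₃ + h₄ + h₅)
    (hS₂ : S₂ = h₂ * h₃ + h₂ * h₄ + h₂ * h₅ + h₃ * h₄ + h₃ * h₅ + h₄ * h₅)
    (hS₃ : S₃ = h₂ * h₃ * h₄ + h₂ * h₃ * h₅ + h₂ * h₄ * h₅ + h₃ * h₄ * h₅)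
    (hL : L = a * l₁ + b * l₂ + c * l₃ + d * l₄) (hL₂ : L₂ = (b * c - a * d) * H₂)
    (hB₀ : B₀ = (1 + 2 * η) * H + 2 * S₁ + 2 * L)
    (hB₀₂ : B₀₂ = (1 + 2 * η) ^ 2 * H₂ + 2 * (1 + 2 * η) * (H * (S₁ + L)) + 4 * (S₂ + S₁ * L + L₂))
    (hB₀₃ : B₀₃ = 2 * (1 + 2 * η) ^ 2 * (H₂ * (S₁ + L)) + 4 * (1 + 2 * η) * (H * (S₂ + S₁ * L + L₂))
      + 8 * (S₃ + S₂ * L + S₁ * L₂))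
    (qY : Y * Y = 2 * Y₂) (cY : Y * Y * Y = 6 * Y₃) (hB : B = B₀ + 4 * Y) :
    B * B = 2 * (B₀₂ + 4 * (B₀ * Y) + 16 * Y₂) ∧
      B * B * B = 6 * (B₀₃ + 4 * (B₀₂ * Y) + 16 * (B₀ * Y₂) + 64 * Y₃) := by
  subst hΛ
  haveI := TwoSlotGlue.isMulCommutative_twoVectorSubalgebra (R := R) (M := M)
  set Λ := Algebra.adjoin R (Set.range fun p : M × M => ι R p.1 * ι R p.2)
  have mh₀ : h₀ ∈ Λ := Algebra.subset_adjoin ⟨(x 0, x 1), hh₀.symm⟩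
  have mh₁ : h₁ ∈ Λ := Algebra.subset_adjoin ⟨(x 2, x 3), hh₁.symm⟩
  have ml₁ : l₁ ∈ Λ := Algebra.subset_adjoin ⟨(x 0, x 2), hl₁.symm⟩
  have ml₂ : l₂ ∈ Λ := Algebra.subset_adjoin ⟨(x 0, x 3), hl₂.symm⟩
  have ml₃ : l₃ ∈ Λ := Algebra.subset_adjoin ⟨(x 1, x 2), hl₃.symm⟩
  have ml₄ : l₄ ∈ Λ := Algebra.subset_adjoin ⟨(x 1, x 3), hl₄.symm⟩
  have mh₂ : h₂ ∈ Λ := Algebra.subset_adjoin ⟨(x 4, x 5), hh₂.symm⟩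
  have mh₃ : h₃ ∈ Λ := Algebra.subset_adjoin ⟨(x 6, x 7), hh₃.symm⟩
  have mh₄ : h₄ ∈ Λ := Algebra.subset_adjoin ⟨(x 8, x 9), hh₄.symm⟩
  have mh₅ : h₅ ∈ Λ := Algebra.subset_adjoin ⟨(x 10, x 11), hh₅.symm⟩
  have qh₀ : (⟨h₀, mh₀⟩ : Λ) * ⟨h₀, mh₀⟩ = 0 := Subtype.ext (by subst hh₀; exact twoVector_mul_self (x 0) (x 1))
  have qh₁ : (⟨h₁, mh₁⟩ : Λ) * ⟨h₁, mh₁⟩ = 0 := Subtype.ext (by subst hh₁; exact twoVector_mul_self (x 2) (x 3))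
  have qh₂ : (⟨h₂, mh₂⟩ : Λ) * ⟨h₂, mh₂⟩ = 0 := Subtype.ext (by subst hh₂; exact twoVector_mul_self (x 4) (x 5))
  have qh₃ : (⟨h₃, mh₃⟩ : Λ) * ⟨h₃, mh₃⟩ = 0 := Subtype.ext (by subst hh₃; exact twoVector_mul_self (x 6) (x 7))
  have qh₄ : (⟨h₄, mh₄⟩ : Λ) * ⟨h₄, mh₄⟩ = 0 := Subtype.ext (by subst hh₄; exact twoVector_mul_self (x 8) (x 9))
  have qh₅ : (⟨h₅, mh₅⟩ : Λ) * ⟨h₅, mh₅⟩ = 0 := Subtype.ext (by subst hh₅; exact twoVector_mul_self (x 10) (x 11))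
  have ql₁ : (⟨l₁, ml₁⟩ : Λ) * ⟨l₁, ml₁⟩ = 0 := Subtype.ext (by subst hl₁; exact twoVector_mul_self (x 0) (x 2))
  have ql₂ : (⟨l₂, ml₂⟩ : Λ) * ⟨l₂, ml₂⟩ = 0 := Subtype.ext (by subst hl₂; exact twoVector_mul_self (x 0) (x 3))
  have ql₃ : (⟨l₃, ml₃⟩ : Λ) * ⟨l₃, ml₃⟩ = 0 := Subtype.ext (by subst hl₃; exact twoVector_mul_self (x 1) (x 2))
  have ql₄ : (⟨l₄, ml₄⟩ : Λ) * ⟨l₄, ml₄⟩ = 0 := Subtype.ext (by subst hl₄; exact twoVector_mul_self (x 1) (x 3))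
  have zh₀l₁ : (⟨h₀, mh₀⟩ : Λ) * ⟨l₁, ml₁⟩ = 0 := Subtype.ext (by subst hh₀ hl₁; exact table_zero_ff (x 0) (x 1) (x 2))
  have zh₀l₂ : (⟨h₀, mh₀⟩ : Λ) * ⟨l₂, ml₂⟩ = 0 := Subtype.ext (by subst hh₀ hl₂; exact table_zero_ff (x 0) (x 1) (x 3))
  have zh₀l₃ : (⟨h₀, mh₀⟩ : Λ) * ⟨l₃, ml₃⟩ = 0 := Subtype.ext (by subst hh₀ hl₃; exact table_zero_st (x 0) (x 1) (x 2))
  have zh₀l₄ : (⟨h₀, mh₀⟩ : Λ) * ⟨l₄, ml₄⟩ = 0 := Subtype.ext (by subst hh₀ hl₄; exact table_zero_st (x 0) (x 1) (x 3))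
  have zh₁l₁ : (⟨h₁, mh₁⟩ : Λ) * ⟨l₁, ml₁⟩ = 0 := Subtype.ext (by subst hh₁ hl₁; exact table_zero_fl (x 2) (x 3) (x 0))
  have zh₁l₂ : (⟨h₁, mh₁⟩ : Λ) * ⟨l₂, ml₂⟩ = 0 := Subtype.ext (by subst hh₁ hl₂; exact table_zero_sl (x 2) (x 3) (x 0))
  have zh₁l₃ : (⟨h₁, mh₁⟩ : Λ) * ⟨l₃, ml₃⟩ = 0 := Subtype.ext (by subst hh₁ hl₃; exact table_zero_fl (x 2) (x 3) (x 1))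
  have zh₁l₄ : (⟨h₁, mh₁⟩ : Λ) * ⟨l₄, ml₄⟩ = 0 := Subtype.ext (by subst hh₁ hl₄; exact table_zero_sl (x 2) (x 3) (x 1))
  have zl₁l₂ : (⟨l₁, ml₁⟩ : Λ) * ⟨l₂, ml₂⟩ = 0 := Subtype.ext (by subst hl₁ hl₂; exact table_zero_ff (x 0) (x 2) (x 3))
  have zl₁l₃ : (⟨l₁, ml₁⟩ : Λ) * ⟨l₃, ml₃⟩ = 0 := Subtype.ext (by subst hl₁ hl₃; exact table_zero_sl (x 0) (x 2) (x 1))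
  have zl₂l₄ : (⟨l₂, ml₂⟩ : Λ) * ⟨l₄, ml₄⟩ = 0 := Subtype.ext (by subst hl₂ hl₄; exact table_zero_sl (x 0) (x 3) (x 1))
  have zl₃l₄ : (⟨l₃, ml₃⟩ : Λ) * ⟨l₄, ml₄⟩ = 0 := Subtype.ext (by subst hl₃ hl₄; exact table_zero_ff (x 1) (x 2) (x 3))
  have pl₁l₄ : (⟨l₁, ml₁⟩ : Λ) * ⟨l₄, ml₄⟩ = -(⟨h₀, mh₀⟩ * ⟨h₁, mh₁⟩) :=
    Subtype.ext (by subst hl₁ hl₄ hh₀ hh₁; exact (table_signed (x 0) (x 1) (x 2) (x 3)).1)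
  have pl₂l₃ : (⟨l₂, ml₂⟩ : Λ) * ⟨l₃, ml₃⟩ = ⟨h₀, mh₀⟩ * ⟨h₁, mh₁⟩ :=
    Subtype.ext (by subst hl₂ hl₃ hh₀ hh₁; exact (table_signed (x 0) (x 1) (x 2) (x 3)).2)
  -- atoms in Λ
  have mH : H ∈ Λ := by subst hH; exact Λ.add_mem mh₀ mh₁
  have mH₂ : H₂ ∈ Λ := by subst hH₂; exact Λ.mul_mem mh₀ mh₁
  have hHΛ : (⟨H, mH⟩ : Λ) = ⟨h₀, mh₀⟩ + ⟨h₁, mh₁⟩ := Subtype.ext (by push_cast; exact hH)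
  have hH₂Λ : (⟨H₂, mH₂⟩ : Λ) = ⟨h₀, mh₀⟩ * ⟨h₁, mh₁⟩ := Subtype.ext (by push_cast; exact hH₂)
  have qH := pairSum_sq (R := Λ) _ _ _ _ hHΛ hH₂Λ qh₀ qh₁
  have zHH₂ := pairSum_mul (R := Λ) _ _ _ _ hHΛ hH₂Λ qh₀ qh₁
  have mS₁ : S₁ ∈ Λ := by subst hS₁; exact Λ.add_mem (Λ.add_mem (Λ.add_mem mh₂ mh₃) mh₄) mh₅
  have mS₂ : S₂ ∈ Λ := by
    subst hS₂; exact Λ.add_mem (Λ.add_mem (Λ.add_mem (Λ.add_mem (Λ.add_mem (Λ.mul_mem mh₂ mh₃)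
      (Λ.mul_mem mh₂ mh₄)) (Λ.mul_mem mh₂ mh₅)) (Λ.mul_mem mh₃ mh₄)) (Λ.mul_mem mh₃ mh₅)) (Λ.mul_mem mh₄ mh₅)
  have mS₃ : S₃ ∈ Λ := by
    subst hS₃; exact Λ.add_mem (Λ.add_mem (Λ.add_mem (Λ.mul_mem (Λ.mul_mem mh₂ mh₃) mh₄)
      (Λ.mul_mem (Λ.mul_mem mh₂ mh₃) mh₅)) (Λ.mul_mem (Λ.mul_mem mh₂ mh₄) mh₅)) (Λ.mul_mem (Λ.mul_mem mh₃ mh₄) mh₅)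
  have hS₁Λ : (⟨S₁, mS₁⟩ : Λ) = ⟨h₂, mh₂⟩ + ⟨h₃, mh₃⟩ + ⟨h₄, mh₄⟩ + ⟨h₅, mh₅⟩ :=
    Subtype.ext (by push_cast; exact hS₁)
  have hS₂Λ : (⟨S₂, mS₂⟩ : Λ) = ⟨h₂, mh₂⟩ * ⟨h₃, mh₃⟩ + ⟨h₂, mh₂⟩ * ⟨h₄, mh₄⟩ + ⟨h₂, mh₂⟩ * ⟨h₅, mh₅⟩
      + ⟨h₃, mh₃⟩ * ⟨h₄, mh₄⟩ + ⟨h₃, mh₃⟩ * ⟨h₅, mh₅⟩ + ⟨h₄, mh₄⟩ * ⟨h₅, mh₅⟩ :=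
    Subtype.ext (by push_cast; exact hS₂)
  have hS₃Λ : (⟨S₃, mS₃⟩ : Λ) = ⟨h₂, mh₂⟩ * ⟨h₃, mh₃⟩ * ⟨h₄, mh₄⟩ + ⟨h₂, mh₂⟩ * ⟨h₃, mh₃⟩ * ⟨h₅, mh₅⟩
      + ⟨h₂, mh₂⟩ * ⟨h₄, mh₄⟩ * ⟨h₅, mh₅⟩ + ⟨h₃, mh₃⟩ * ⟨h₄, mh₄⟩ * ⟨h₅, mh₅⟩ :=
    Subtype.ext (by push_cast; exact hS₃)
  have qS₁₁ := slotSum_11 (R := Λ) _ _ _ _ _ _ hS₁Λ hS₂Λ qh₂ qh₃ qh₄ qh₅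
  have qS₁₂ := slotSum_12 (R := Λ) _ _ _ _ _ _ _ hS₁Λ hS₂Λ hS₃Λ qh₂ qh₃ qh₄ qh₅
  have mL : L ∈ Λ := by
    subst hL; exact Λ.add_mem (Λ.add_mem (Λ.add_mem (Λ.mul_mem ma ml₁) (Λ.mul_mem mb ml₂)) (Λ.mul_mem mc ml₃))
      (Λ.mul_mem md ml₄)
  have hLΛ : (⟨L, mL⟩ : Λ) = ⟨a, ma⟩ * ⟨l₁, ml₁⟩ + ⟨b, mb⟩ * ⟨l₂, ml₂⟩ + ⟨c, mc⟩ * ⟨l₃, ml₃⟩ + ⟨d, md⟩ * ⟨l₄, ml₄⟩ :=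
    Subtype.ext (by push_cast; exact hL)
  have zh₀L := crossLine_h₀ (R := Λ) _ _ _ _ _ _ _ _ _ _ hLΛ zh₀l₁ zh₀l₂ zh₀l₃ zh₀l₄
  have zh₁L := crossLine_h₁ (R := Λ) _ _ _ _ _ _ _ _ _ _ hLΛ zh₁l₁ zh₁l₂ zh₁l₃ zh₁l₄
  have zHL : (⟨H, mH⟩ : Λ) * ⟨L, mL⟩ = 0 := by rw [hHΛ, add_mul, zh₀L, zh₁L, add_zero]
  have zH₂L : (⟨H₂, mH₂⟩ : Λ) * ⟨L, mL⟩ = 0 := by rw [hH₂Λ, mul_assoc, zh₁L, mul_zero]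
  have mL₂ : L₂ ∈ Λ := by subst hL₂; exact Λ.mul_mem (Λ.sub_mem (Λ.mul_mem mb mc) (Λ.mul_mem ma md)) mH₂
  have hL₂Λ : (⟨L₂, mL₂⟩ : Λ) = (⟨b, mb⟩ * ⟨c, mc⟩ - ⟨a, ma⟩ * ⟨d, md⟩) * ⟨H₂, mH₂⟩ :=
    Subtype.ext (by push_cast; exact hL₂)
  have qL : (⟨L, mL⟩ : Λ) * ⟨L, mL⟩ = 2 * ⟨L₂, mL₂⟩ := by
    rw [crossLine_sq (R := Λ) _ _ _ _ _ _ _ _ _ _ _ hLΛ ql₁ ql₂ ql₃ ql₄ zl₁l₂ zl₁l₃ zl₂l₄ zl₃l₄ pl₁l₄ pl₂l₃,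
      hL₂Λ, hH₂Λ]
  -- the registered closed forms of `B₀` in Λ and the pinning identities
  have mB₀ : B₀ ∈ Λ := by
    subst hB₀; exact Λ.add_mem (Λ.add_mem (Λ.mul_mem (Λ.add_mem (Λ.one_mem) (Λ.mul_mem (Λ.natCast_mem 2) mη)) mH)
      (Λ.mul_mem (Λ.natCast_mem 2) mS₁)) (Λ.mul_mem (Λ.natCast_mem 2) mL)
  have hB₀Λ : (⟨B₀, mB₀⟩ : Λ) = (1 + 2 * ⟨η, mη⟩) * ⟨H, mH⟩ + 2 * ⟨S₁, mS₁⟩ + 2 * ⟨L, mL⟩ :=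
    Subtype.ext (by push_cast; exact hB₀)
  have mB₀₂ : B₀₂ ∈ Λ := by
    subst hB₀₂
    exact Λ.add_mem (Λ.add_mem (Λ.mul_mem (Λ.pow_mem (Λ.add_mem Λ.one_mem (Λ.mul_mem (Λ.natCast_mem 2) mη)) 2) mH₂)
      (Λ.mul_mem (Λ.mul_mem (Λ.natCast_mem 2) (Λ.add_mem Λ.one_mem (Λ.mul_mem (Λ.natCast_mem 2) mη)))
        (Λ.mul_mem mH (Λ.add_mem mS₁ mL))))
      (Λ.mul_mem (Λ.natCast_mem 4) (Λ.add_mem (Λ.add_mem mS₂ (Λ.mul_mem mS₁ mL)) mL₂))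
  have hB₀₂Λ : (⟨B₀₂, mB₀₂⟩ : Λ) = (1 + 2 * ⟨η, mη⟩) ^ 2 * ⟨H₂, mH₂⟩ + 2 * (1 + 2 * ⟨η, mη⟩) * (⟨H, mH⟩ *
      (⟨S₁, mS₁⟩ + ⟨L, mL⟩)) + 4 * (⟨S₂, mS₂⟩ + ⟨S₁, mS₁⟩ * ⟨L, mL⟩ + ⟨L₂, mL₂⟩) :=
    Subtype.ext (by push_cast; exact hB₀₂)
  have mB₀₃ : B₀₃ ∈ Λ := by
    subst hB₀₃
    exact Λ.add_mem (Λ.add_mem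
      (Λ.mul_mem (Λ.mul_mem (Λ.natCast_mem 2) (Λ.pow_mem (Λ.add_mem Λ.one_mem (Λ.mul_mem (Λ.natCast_mem 2) mη)) 2))
        (Λ.mul_mem mH₂ (Λ.add_mem mS₁ mL)))
      (Λ.mul_mem (Λ.mul_mem (Λ.natCast_mem 4) (Λ.add_mem Λ.one_mem (Λ.mul_mem (Λ.natCast_mem 2) mη)))
        (Λ.mul_mem mH (Λ.add_mem (Λ.add_mem mS₂ (Λ.mul_mem mS₁ mL)) mL₂))))
      (Λ.mul_mem (Λ.natCast_mem 8) (Λ.add_mem (Λ.add_mem mS₃ (Λ.mul_mem mS₂ mL)) (Λ.mul_mem mS₁ mL₂)))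
  have hB₀₃Λ : (⟨B₀₃, mB₀₃⟩ : Λ) = 2 * (1 + 2 * ⟨η, mη⟩) ^ 2 * (⟨H₂, mH₂⟩ * (⟨S₁, mS₁⟩ + ⟨L, mL⟩))
      + 4 * (1 + 2 * ⟨η, mη⟩) * (⟨H, mH⟩ * (⟨S₂, mS₂⟩ + ⟨S₁, mS₁⟩ * ⟨L, mL⟩ + ⟨L₂, mL₂⟩))
      + 8 * (⟨S₃, mS₃⟩ + ⟨S₂, mS₂⟩ * ⟨L, mL⟩ + ⟨S₁, mS₁⟩ * ⟨L₂, mL₂⟩) :=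
    Subtype.ext (by push_cast; exact hB₀₃)
  have qB₀ := sq_B (R := Λ) ⟨η, mη⟩ _ _ _ _ _ _ _ _ hB₀Λ hB₀₂Λ qH qS₁₁ qL
  have cB₀ := cube_B (R := Λ) ⟨η, mη⟩ (⟨b, mb⟩ * ⟨c, mc⟩ - ⟨a, ma⟩ * ⟨d, md⟩) _ _ _ _ _ _ _ _ _ hB₀Λ hB₀₃Λ qH
    zHH₂ qS₁₁ qS₁₂ zHL zH₂L qL hL₂Λ
  -- the remainder and the binomial law in Λ, pushed to the exterior algebra
  have qYΛ : (⟨Y, mY⟩ : Λ) * ⟨Y, mY⟩ = 2 * ⟨Y₂, mY₂⟩ := Subtype.ext (by push_cast; exact qY)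
  have cYΛ : (⟨Y, mY⟩ : Λ) * ⟨Y, mY⟩ * ⟨Y, mY⟩ = 6 * ⟨Y₃, mY₃⟩ := Subtype.ext (by push_cast; exact cY)
  have mB : B ∈ Λ := by subst hB; exact Λ.add_mem mB₀ (Λ.mul_mem (Λ.natCast_mem 4) mY)
  have hBΛ : (⟨B, mB⟩ : Λ) = ⟨B₀, mB₀⟩ + 4 * ⟨Y, mY⟩ := Subtype.ext (by push_cast; exact hB)
  have k₂ := congrArg Subtype.val (sq_shift_four (R := Λ) _ _ _ _ _ hBΛ qB₀ qYΛ)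
  have k₃ := congrArg Subtype.val (cube_shift_four (R := Λ) _ _ _ _ _ _ _ hBΛ qB₀ cB₀ qYΛ cYΛ)
  push_cast at k₂ k₃
  exact ⟨k₂, k₃⟩

end Exterior

end Summit.Ventures.HSemireg.EdgeUnitClosedForms
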